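import Summits.QuantumFields.YangMills.Theorems.EquipartitionCriticalityEquipartitionPinsProbeRigidityA
import HarnessLib

/-!
# Rigidity of the lattice Maxwell field under the equipartition budget — part B (test cochains, defect identity)

Route `EquipartitionCriticality` of `YangMills`, crux item `stmt-QuantumFields-8760`
(`EquipartitionPinsProbe`), line `Sketch`, STUB R (`stub_rigidity`) of the lead prover: every
probability measure `τ` on `ℝ^D`-valued 2-cochains `Y : ZdPlaquette 4 → Fin D → ℝ` of `ℤ⁴` that is
a.s. closed, has uniformly bounded second moments with the equipartition budget, and satisfies the
(trigonometric) Stein identity of the lattice Maxwell field IS `curvatureGaussianField 4 D`.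

This file: the indicator and axial line-average test cochains (pairings, quadratic forms,
plane–colour sums), restriction of the index set, and the limit lemma reading the second-moment
defect `E X² − Q` off the function `s ↦ e^{s²Q/2} E cos(s X)` (`defect_eq`).
-/

noncomputable section

open MeasureTheory Filter Topology
open scoped BigOperators
open Literature.MathematicalPhysics.QuantumFieldTheory Literature.MathematicalPhysics.QuantumLattice
open Literature.Probability.LatticeModels

namespace Summit.QuantumFields.YangMills.Theorems.EquipartitionPinsProbe

namespace Rigidity

/-! ## Part B — test cochains, restriction, and the second-moment identity -/

section TestCochains

variable {D : ℕ}

/-- Pairing with the indicator cochain of `(p₀, a)`: `⟨Y, δ_{p₀,a}⟩_S = Y_{p₀}^a` (`p₀ ∈ S`). -/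
theorem pair_delta (S : Finset (ZdPlaquette 4)) {p₀ : ZdPlaquette 4} (hp₀ : p₀ ∈ S) (a : Fin D)
    (Y : ZdPlaquette 4 → Fin D → ℝ) :
    (∑ p ∈ S, ∑ b : Fin D, (if p = p₀ ∧ b = a then (1 : ℝ) else 0) * Y p b) = Y p₀ a := by
  classical
  have : ∀ p ∈ S, (∑ b : Fin D, (if p = p₀ ∧ b = a then (1 : ℝ) else 0) * Y p b) =
      if p = p₀ then Y p₀ a else 0 := by
    intro p _
    by_cases hp : p = p₀
    · subst hp
      simp
    · simp [hp]
  rw [Finset.sum_congr rfl this, Finset.sum_ite_eq' S p₀, if_pos hp₀]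

/-- Quadratic form of the indicator cochain: `Q_S(δ_{p₀,a}) = T(p₀,p₀)` (`p₀ ∈ S`). -/
theorem quad_delta (S : Finset (ZdPlaquette 4)) {p₀ : ZdPlaquette 4} (hp₀ : p₀ ∈ S) (a : Fin D) :
    (∑ p ∈ S, ∑ q ∈ S, ∑ b : Fin D, (if p = p₀ ∧ b = a then (1 : ℝ) else 0) *
        (if q = p₀ ∧ b = a then (1 : ℝ) else 0) * curvatureTwoPoint p q) =
      curvatureTwoPoint p₀ p₀ := by
  classical
  have inner : ∀ p ∈ S, (∑ q ∈ S, ∑ b : Fin D, (if p = p₀ ∧ b = a then (1 : ℝ) else 0) *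
      (if q = p₀ ∧ b = a then (1 : ℝ) else 0) * curvatureTwoPoint p q) =
      if p = p₀ then curvatureTwoPoint p₀ p₀ else 0 := by
    intro p _
    by_cases hp : p = p₀
    · subst hp
      have : ∀ q ∈ S, (∑ b : Fin D, (if p = p ∧ b = a then (1 : ℝ) else 0) *
          (if q = p ∧ b = a then (1 : ℝ) else 0) * curvatureTwoPoint p q) =
          if q = p then curvatureTwoPoint p p else 0 := by
        intro q _
        by_cases hq : q = p
        · subst hq; simp
        · simp [hq]
      rw [Finset.sum_congr rfl this, Finset.sum_ite_eq' S p, if_pos hp₀, if_pos rfl]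
    · simp [hp]
  rw [Finset.sum_congr rfl inner, Finset.sum_ite_eq' S p₀, if_pos hp₀]

/-- Plane–colour sums of the indicator cochain. -/
theorem planeSum_delta (S : Finset (ZdPlaquette 4)) {p₀ : ZdPlaquette 4} (hp₀ : p₀ ∈ S) (a b : Fin D)
    (pl : {q : Fin 4 × Fin 4 // q.1 < q.2}) :
    (∑ p ∈ S, if p.2 = pl then (if p = p₀ ∧ b = a then (1 : ℝ) else 0) else 0) =
      if p₀.2 = pl ∧ b = a then 1 else 0 := by
  classical
  have : ∀ p ∈ S, (if p.2 = pl then (if p = p₀ ∧ b = a then (1 : ℝ) else 0) else 0) =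
      if p = p₀ then (if p₀.2 = pl ∧ b = a then 1 else 0) else 0 := by
    intro p _
    by_cases hp : p = p₀
    · subst hp
      by_cases h1 : p.2 = pl <;> by_cases h2 : b = a <;> simp [h1, h2]
    · simp [hp]
  rw [Finset.sum_congr rfl this, Finset.sum_ite_eq' S p₀, if_pos hp₀]

variable (i j : Fin 4) (hij : i < j)

/-- The `t`-th plaquette of the axial line in the `(i,j)` plane: `(t e₀; i, j)`. -/
theorem linePt_injective :
    Function.Injective fun t : ℕ =>
      (((Pi.single (0 : Fin 4) (t : ℤ) : Site 4), ⟨(i, j), hij⟩) : ZdPlaquette 4) := by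
  intro s t hst
  have h1 := congrArg (fun q : ZdPlaquette 4 => q.1 0) hst
  simpa using h1

/-- Pairing with the line-average cochain: `⟨Y, h_L⟩_S = L⁻¹ ∑_{t<L} Y^a_{(te₀;i,j)}`. -/
theorem pair_line (S : Finset (ZdPlaquette 4)) (L : ℕ) (a : Fin D)
    (hS : ∀ t ∈ Finset.range L,
      (((Pi.single (0 : Fin 4) (t : ℤ) : Site 4), ⟨(i, j), hij⟩) : ZdPlaquette 4) ∈ S)
    (Y : ZdPlaquette 4 → Fin D → ℝ) :
    (∑ p ∈ S, ∑ b : Fin D, (if b = a then (∑ t ∈ Finset.range L,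
        if p = (((Pi.single (0 : Fin 4) (t : ℤ) : Site 4), ⟨(i, j), hij⟩) : ZdPlaquette 4)
          then (1 : ℝ) else 0) / L else 0) * Y p b) =
      (∑ t ∈ Finset.range L,
        Y (((Pi.single (0 : Fin 4) (t : ℤ) : Site 4), ⟨(i, j), hij⟩)) a) / L := by
  classical
  simp only [ite_mul, zero_mul, Finset.sum_ite_eq', Finset.mem_univ, if_true]
  have e : ∀ x ∈ S, (∑ t ∈ Finset.range L,
      if x = (((Pi.single (0 : Fin 4) (t : ℤ) : Site 4), ⟨(i, j), hij⟩) : ZdPlaquette 4)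
        then (1 : ℝ) else 0) / L * Y x a =
      ∑ t ∈ Finset.range L,
        (if x = (((Pi.single (0 : Fin 4) (t : ℤ) : Site 4), ⟨(i, j), hij⟩) : ZdPlaquette 4)
          then Y x a / L else 0) := by
    intro x _
    rw [Finset.sum_div, Finset.sum_mul]
    refine Finset.sum_congr rfl fun t _ => ?_
    split_ifs <;> ring
  rw [Finset.sum_congr rfl e, Finset.sum_comm, Finset.sum_div]
  refine Finset.sum_congr rfl fun t ht => ?_
  rw [Finset.sum_ite_eq' S, if_pos (hS t ht)]

/-- Sums against the line-average weights: `∑_{p∈S} (L⁻¹ ∑_{t<L} [p = (te₀;i,j)]) g(p) =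
L⁻¹ ∑_{t<L} g(te₀;i,j)` when the line lies in `S`. -/
theorem sum_lineAvg_mul (S : Finset (ZdPlaquette 4)) (L : ℕ)
    (hS : ∀ t ∈ Finset.range L,
      (((Pi.single (0 : Fin 4) (t : ℤ) : Site 4), ⟨(i, j), hij⟩) : ZdPlaquette 4) ∈ S)
    (g : ZdPlaquette 4 → ℝ) :
    (∑ p ∈ S, (∑ t ∈ Finset.range L,
        if p = (((Pi.single (0 : Fin 4) (t : ℤ) : Site 4), ⟨(i, j), hij⟩) : ZdPlaquette 4)
          then (1 : ℝ) else 0) / L * g p) =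
      (∑ t ∈ Finset.range L, g (((Pi.single (0 : Fin 4) (t : ℤ) : Site 4), ⟨(i, j), hij⟩))) / L := by
  classical
  have e : ∀ x ∈ S, (∑ t ∈ Finset.range L,
      if x = (((Pi.single (0 : Fin 4) (t : ℤ) : Site 4), ⟨(i, j), hij⟩) : ZdPlaquette 4)
        then (1 : ℝ) else 0) / L * g x =
      ∑ t ∈ Finset.range L,
        (if x = (((Pi.single (0 : Fin 4) (t : ℤ) : Site 4), ⟨(i, j), hij⟩) : ZdPlaquette 4)
          then g x / L else 0) := by
    intro x _
    rw [Finset.sum_div, Finset.sum_mul]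
    refine Finset.sum_congr rfl fun t _ => ?_
    split_ifs <;> ring
  rw [Finset.sum_congr rfl e, Finset.sum_comm, Finset.sum_div]
  refine Finset.sum_congr rfl fun t ht => ?_
  rw [Finset.sum_ite_eq' S, if_pos (hS t ht)]

/-- Quadratic form of the line-average cochain:
`Q_S(h_L) = L⁻² ∑_{s,t<L} T((se₀;i,j),(te₀;i,j))`. -/
theorem quad_line (S : Finset (ZdPlaquette 4)) (L : ℕ) (a : Fin D)
    (hS : ∀ t ∈ Finset.range L,
      (((Pi.single (0 : Fin 4) (t : ℤ) : Site 4), ⟨(i, j), hij⟩) : ZdPlaquette 4) ∈ S) :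
    (∑ p ∈ S, ∑ q ∈ S, ∑ b : Fin D,
      (if b = a then (∑ t ∈ Finset.range L,
        if p = (((Pi.single (0 : Fin 4) (t : ℤ) : Site 4), ⟨(i, j), hij⟩) : ZdPlaquette 4)
          then (1 : ℝ) else 0) / L else 0) *
      (if b = a then (∑ t ∈ Finset.range L,
        if q = (((Pi.single (0 : Fin 4) (t : ℤ) : Site 4), ⟨(i, j), hij⟩) : ZdPlaquette 4)
          then (1 : ℝ) else 0) / L else 0) * curvatureTwoPoint p q) =
      (∑ s ∈ Finset.range L, ∑ t ∈ Finset.range L,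
        curvatureTwoPoint ((Pi.single (0 : Fin 4) (s : ℤ) : Site 4), ⟨(i, j), hij⟩)
          ((Pi.single (0 : Fin 4) (t : ℤ) : Site 4), ⟨(i, j), hij⟩)) / ((L : ℝ) ^ 2) := by
  classical
  -- collapse the colour sum
  have colour : ∀ (p q : ZdPlaquette 4), (∑ b : Fin D,
      (if b = a then (∑ t ∈ Finset.range L,
        if p = (((Pi.single (0 : Fin 4) (t : ℤ) : Site 4), ⟨(i, j), hij⟩) : ZdPlaquette 4)
          then (1 : ℝ) else 0) / L else 0) *
      (if b = a then (∑ t ∈ Finset.range L,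
        if q = (((Pi.single (0 : Fin 4) (t : ℤ) : Site 4), ⟨(i, j), hij⟩) : ZdPlaquette 4)
          then (1 : ℝ) else 0) / L else 0) * curvatureTwoPoint p q) =
      (∑ t ∈ Finset.range L,
        if p = (((Pi.single (0 : Fin 4) (t : ℤ) : Site 4), ⟨(i, j), hij⟩) : ZdPlaquette 4)
          then (1 : ℝ) else 0) / L *
      ((∑ t ∈ Finset.range L,
        if q = (((Pi.single (0 : Fin 4) (t : ℤ) : Site 4), ⟨(i, j), hij⟩) : ZdPlaquette 4)
          then (1 : ℝ) else 0) / L * curvatureTwoPoint p q) := by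
    intro p q
    simp only [ite_mul, zero_mul, Finset.sum_ite_eq', Finset.mem_univ, if_true]
    ring
  simp only [colour]
  have inner : ∀ p ∈ S, (∑ q ∈ S, (∑ t ∈ Finset.range L,
        if p = (((Pi.single (0 : Fin 4) (t : ℤ) : Site 4), ⟨(i, j), hij⟩) : ZdPlaquette 4)
          then (1 : ℝ) else 0) / L *
      ((∑ t ∈ Finset.range L,
        if q = (((Pi.single (0 : Fin 4) (t : ℤ) : Site 4), ⟨(i, j), hij⟩) : ZdPlaquette 4)
          then (1 : ℝ) else 0) / L * curvatureTwoPoint p q)) =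
      (∑ t ∈ Finset.range L,
        if p = (((Pi.single (0 : Fin 4) (t : ℤ) : Site 4), ⟨(i, j), hij⟩) : ZdPlaquette 4)
          then (1 : ℝ) else 0) / L *
      ((∑ t ∈ Finset.range L, curvatureTwoPoint p
          ((Pi.single (0 : Fin 4) (t : ℤ) : Site 4), ⟨(i, j), hij⟩)) / L) := by
    intro p _
    rw [← Finset.mul_sum, sum_lineAvg_mul i j hij S L hS (fun q => curvatureTwoPoint p q)]
  rw [Finset.sum_congr rfl inner, sum_lineAvg_mul i j hij S L hS, ← Finset.sum_div, div_div, sq]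

/-- Plane–colour sums of the line-average cochain. -/
theorem planeSum_line (S : Finset (ZdPlaquette 4)) (L : ℕ) (a b : Fin D)
    (hS : ∀ t ∈ Finset.range L,
      (((Pi.single (0 : Fin 4) (t : ℤ) : Site 4), ⟨(i, j), hij⟩) : ZdPlaquette 4) ∈ S)
    (pl : {q : Fin 4 × Fin 4 // q.1 < q.2}) :
    (∑ p ∈ S, if p.2 = pl then (if b = a then (∑ t ∈ Finset.range L,
        if p = (((Pi.single (0 : Fin 4) (t : ℤ) : Site 4), ⟨(i, j), hij⟩) : ZdPlaquette 4)
          then (1 : ℝ) else 0) / L else 0) else 0) =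
      if (⟨(i, j), hij⟩ : {q : Fin 4 × Fin 4 // q.1 < q.2}) = pl ∧ b = a then
        ((Finset.range L).card : ℝ) / L else 0 := by
  classical
  by_cases hb : b = a
  · simp only [hb, and_true, if_true]
    have e : ∀ p ∈ S, (if p.2 = pl then (∑ t ∈ Finset.range L,
        if p = (((Pi.single (0 : Fin 4) (t : ℤ) : Site 4), ⟨(i, j), hij⟩) : ZdPlaquette 4)
          then (1 : ℝ) else 0) / L else 0) =
        (∑ t ∈ Finset.range L,
          if p = (((Pi.single (0 : Fin 4) (t : ℤ) : Site 4), ⟨(i, j), hij⟩) : ZdPlaquette 4)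
            then (1 : ℝ) else 0) / L * (if p.2 = pl then 1 else 0) := by
      intro p _
      split_ifs <;> simp
    rw [Finset.sum_congr rfl e, sum_lineAvg_mul i j hij S L hS]
    by_cases hpl : (⟨(i, j), hij⟩ : {q : Fin 4 × Fin 4 // q.1 < q.2}) = pl
    · simp [hpl]
    · simp [hpl]
  · simp [hb]

/-! ### Restriction to a larger index set -/

/-- Extending the index set with zero values does not change the pairing. -/
theorem pair_restrict {S S' : Finset (ZdPlaquette 4)} (hSS' : S ⊆ S')
    (h : ZdPlaquette 4 → Fin D → ℝ) (Y : ZdPlaquette 4 → Fin D → ℝ) :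
    (∑ p ∈ S', ∑ b : Fin D, (if p ∈ S then h p b else 0) * Y p b) =
      ∑ p ∈ S, ∑ b : Fin D, h p b * Y p b := by
  classical
  rw [← Finset.sum_subset hSS']
  · exact Finset.sum_congr rfl fun p hp => by simp [hp]
  · intro p _ hp
    simp [hp]

/-- Extending the index set with zero values does not change the quadratic form. -/
theorem quad_restrict {S S' : Finset (ZdPlaquette 4)} (hSS' : S ⊆ S')
    (h : ZdPlaquette 4 → Fin D → ℝ) :
    (∑ p ∈ S', ∑ q ∈ S', ∑ b : Fin D, (if p ∈ S then h p b else 0) *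
        (if q ∈ S then h q b else 0) * curvatureTwoPoint p q) =
      ∑ p ∈ S, ∑ q ∈ S, ∑ b : Fin D, h p b * h q b * curvatureTwoPoint p q := by
  classical
  rw [← Finset.sum_subset hSS']
  · refine Finset.sum_congr rfl fun p hp => ?_
    rw [← Finset.sum_subset hSS']
    · exact Finset.sum_congr rfl fun q hq => by simp [hp, hq]
    · intro q _ hq
      simp [hq]
  · intro p _ hp
    simp [hp]

/-- Extending the index set with zero values does not change the plane–colour sums. -/
theorem planeSum_restrict {S S' : Finset (ZdPlaquette 4)} (hSS' : S ⊆ S')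
    (h : ZdPlaquette 4 → Fin D → ℝ) (b : Fin D) (pl : {q : Fin 4 × Fin 4 // q.1 < q.2}) :
    (∑ p ∈ S', if p.2 = pl then (if p ∈ S then h p b else 0) else 0) =
      ∑ p ∈ S, if p.2 = pl then h p b else 0 := by
  classical
  rw [← Finset.sum_subset hSS']
  · exact Finset.sum_congr rfl fun p hp => by simp [hp]
  · intro p _ hp
    simp [hp]

end TestCochains

/-! ### The second-moment defect is read off `s ↦ e^{s²c} E cos(s X)` -/

/-- If `(1 − C(s))/s² → m` as `s → 0`, then `(1 − e^{s²c} C(s))/s² → m − c`. -/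
theorem tendsto_one_sub_exp_mul_div_sq {C : ℝ → ℝ} {m c : ℝ}
    (hC : Tendsto (fun s => (1 - C s) / s ^ 2) (𝓝[≠] 0) (𝓝 m)) :
    Tendsto (fun s => (1 - Real.exp (s ^ 2 * c) * C s) / s ^ 2) (𝓝[≠] 0) (𝓝 (m - c)) := by
  have h1 : Tendsto (fun s : ℝ => s ^ 2) (𝓝[≠] 0) (𝓝 0) := by
    have := ((continuous_pow 2).tendsto (0 : ℝ))
    simp only [ne_eq, OfNat.ofNat_ne_zero, not_false_eq_true, zero_pow] at this
    exact this.mono_left nhdsWithin_le_nhds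
  have h1' : Tendsto (fun s : ℝ => s ^ 2) (𝓝[≠] 0) (𝓝[≠] 0) :=
    tendsto_nhdsWithin_iff.2 ⟨h1, eventually_mem_nhdsWithin.mono fun s hs => pow_ne_zero 2 hs⟩
  -- `C s → 1`
  have hC1 : Tendsto C (𝓝[≠] 0) (𝓝 1) := by
    have h2 : Tendsto (fun s => 1 - s ^ 2 * ((1 - C s) / s ^ 2)) (𝓝[≠] 0) (𝓝 (1 - 0 * m)) :=
      tendsto_const_nhds.sub (h1.mul hC)
    rw [zero_mul, sub_zero] at h2
    refine h2.congr' (eventually_mem_nhdsWithin.mono fun s hs => ?_)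
    have hs2 : s ^ 2 ≠ 0 := pow_ne_zero 2 hs
    rw [mul_div_cancel₀ _ hs2]
    ring
  -- `(e^{s²c} − 1)/s² → c`
  have hd : HasDerivAt (fun v : ℝ => Real.exp (v * c)) c 0 := by
    have := ((hasDerivAt_id (0 : ℝ)).mul_const c).exp
    simpa using this
  have hE : Tendsto (fun s : ℝ => (Real.exp (s ^ 2 * c) - 1) / s ^ 2) (𝓝[≠] 0) (𝓝 c) := by
    have h3 := hd.tendsto_slope_zero.comp h1'
    refine h3.congr fun s => ?_
    simp only [Function.comp_apply, zero_add, zero_mul, Real.exp_zero, smul_eq_mul]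
    ring
  have key : Tendsto (fun s => (1 - C s) / s ^ 2 - (Real.exp (s ^ 2 * c) - 1) / s ^ 2 * C s)
      (𝓝[≠] 0) (𝓝 (m - c * 1)) := hC.sub (hE.mul hC1)
  rw [mul_one] at key
  refine key.congr fun s => ?_
  ring

/-- **The second-moment defect is an invariant of `Ψ`.** If two square-integrable pairings
`X = ⟨Y,u⟩_S`, `X' = ⟨Y,v⟩_S` satisfy `e^{s²Q(u)/2} E cos(sX) = e^{s²Q(v)/2} E cos(sX')` for all
`s`, then `E X² − Q(u) = E X'² − Q(v)`. -/
theorem defect_eq {C C' : ℝ → ℝ} {m m' Q Q' : ℝ}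
    (hC : Tendsto (fun s => (1 - C s) / s ^ 2) (𝓝[≠] 0) (𝓝 (m / 2)))
    (hC' : Tendsto (fun s => (1 - C' s) / s ^ 2) (𝓝[≠] 0) (𝓝 (m' / 2)))
    (hEq : ∀ s : ℝ, Real.exp (s ^ 2 * Q / 2) * C s = Real.exp (s ^ 2 * Q' / 2) * C' s) :
    m - Q = m' - Q' := by
  have t1 := tendsto_one_sub_exp_mul_div_sq (c := Q / 2) hC
  have t2 := tendsto_one_sub_exp_mul_div_sq (c := Q' / 2) hC'
  have heq : (fun s => (1 - Real.exp (s ^ 2 * (Q / 2)) * C s) / s ^ 2) =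
      fun s => (1 - Real.exp (s ^ 2 * (Q' / 2)) * C' s) / s ^ 2 := by
    funext s
    have := hEq s
    rw [show s ^ 2 * (Q / 2) = s ^ 2 * Q / 2 by ring, show s ^ 2 * (Q' / 2) = s ^ 2 * Q' / 2 by ring,
      this]
  rw [heq] at t1
  have := tendsto_nhds_unique t1 t2
  linarith

end Rigidity

/-- Registered anchor of part B: **the second-moment defect is an invariant of `Ψ`** — if
`(1 − C(s))/s² → m/2`, `(1 − C'(s))/s² → m'/2` and `e^{s²Q/2} C(s) = e^{s²Q'/2} C'(s)` for all `s`,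
then `m − Q = m' − Q'`. -/
theorem stub_rigidityDefectEq :
    ∀ (C C' : ℝ → ℝ) (m m' Q Q' : ℝ),
      Tendsto (fun s => (1 - C s) / s ^ 2) (𝓝[≠] 0) (𝓝 (m / 2)) →
      Tendsto (fun s => (1 - C' s) / s ^ 2) (𝓝[≠] 0) (𝓝 (m' / 2)) →
      (∀ s : ℝ, Real.exp (s ^ 2 * Q / 2) * C s = Real.exp (s ^ 2 * Q' / 2) * C' s) →
      m - Q = m' - Q' :=
  fun _ _ _ _ _ _ hC hC' hEq => Rigidity.defect_eq hC hC' hEq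

end Summit.QuantumFields.YangMills.Theorems.EquipartitionPinsProbe

end
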